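import Summits.HodgeConjecture.HodgeConjecture.Theorems.CyclicUnitaryPowersCupChainFreeSlots
import Summits.HodgeConjecture.HodgeConjecture.Theorems.SignSymmetricPowersMatchingClassesAlgebraic
import Summits.HodgeConjecture.HodgeConjecture.Theorems.Q8SymplecticPowersSummandHodgeNormalForm
import Literature.AlgebraicGeometry.HodgeTheory.DiagonalKunnethComponentCasimir
import Literature.AlgebraicGeometry.HodgeTheory.AlgebraicClassesPullback
import Literature.AlgebraicGeometry.HodgeTheory.HypersurfaceLefschetz
import Literature.AlgebraicGeometry.Motives.FibrePowerSmoothProjective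
import HarnessLib

/-!
# K2Q brick A-Q (route `Q8SymplecticPowers`, item stmt-HodgeConjecture-24191 `PowersHodgeOfQuaternionCommutators`) —
# Künneth insertions of GRAPH matching tensors are algebraic, for EVERY smooth projective surface with `b₁ = 0`

Cell `hodge-nonav`, prover seat `hodge-nonav-20241-p1` (g20); programme K2Q, second brick (KS-Q is
`Q8SymplecticPowersSummandHodgeNormalForm`, p706302). HELPER FILE (`--supports stmt-HodgeConjecture-24191 --as helper`;
proves no registered stub, closes nothing). Sorry-free; axioms standard.

Twin of route A's K2 stub A `CyclicUnitaryPowersMatchingClassesAlgebraicCyclic.stub_matchingClassesAlgebraicCyclic`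
(smooth `p`-cyclic surfaces, pairs tagged by POWERS `(σ^*)^{τ c}` of one deck map) with two generalisations and NO
deck structure: the surface `X` is any smooth projective surface with `b₁(X) = 0`, the pairs `c` of the matching `ε`
are tagged by ARBITRARY morphisms `g c : X ⟶ X` (pair matrix `[(g c)^*]_b · G⁻¹`, `G = (tr(bᵢ ∪ bⱼ))` the Gram matrix of
the trace form on a basis `b` of `H²(X; ℚ)`), and the free slots carry classes `z a ∈ H²(X; ℚ)` with ALGEBRAIC
complexification (divisor classes; for K2Q: the rational `(1,1)`-classes fixed by the typed quaternionic centraliser,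
algebraic by Lefschetz `(1,1)`). For the quaternionic route the tags are words in the deck pair `τ, j` — the four
pairings `tr(x ∪ g^*y)`, `g ∈ {1, τ, j, τ ≫ j}`, of the degree-2 engine `Q8CommutatorDegreeTwoCore` — and a matching
tensor with pair matrices that are linear COMBINATIONS of the `[g^*]_b · G⁻¹` is a linear combination of the tensors
treated here (multilinearity in the pairs), so this brick covers the algebraicity half of both `stub_squareQ` (one pair)
and `stub_higherPowersQ` (perfect matchings with free slots).

* `graphMatchingClassesAlgebraic_of_fulton` — Fulton's pull-back fact as a hypothesis (the binder of the cup-chain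
  re-summation theorem `ofRatClass_sum_smul_cupChain_free_mem_algebraicClasses`);
* `graphMatchingClassesAlgebraic` — Fulton DISCHARGED (`fulton1998_map_mem_algebraicClasses_holds`).

Proof (route A's §1–§3 with the cyclic inputs replaced): the Poincaré Casimir `κ = Σ (G⁻¹)ᵢⱼ pr₁^*bᵢ ∪ pr₂^*bⱼ` of
`H²(X; ℚ)` on `X × X` is algebraic for a surface with `H¹ = H³ = 0` and algebraic `H⁰, H⁴`
(`ofRatClass_casimir_mem_algebraicClasses`, fed by `subsingleton_bettiCohomology_of_odd_of_b₁` and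
`algebraicClasses_eq_top_of_eq_zero_or_le`); absorbing `[(g c)^*]_b` into the first slot
(`SignSymmetricPowersMatchingClassesAlgebraic.sum_toMatrix_mul_smul_eq`, functoriality `pull_comp`) turns the two-slot
insertion of the pair matrix into the pull-back `(f ≫ g c, f')^* κ`, algebraic by Fulton; the free-slot re-summation
`CyclicUnitaryPowersCupChainFreeSlots.ofRatClass_sum_smul_cupChain_free_mem_algebraicClasses` concludes.
Honest scope: bookkeeping; nothing here says HC, HC_CM or HC_AV is proved.

References: C. Voisin, *Hodge Theory I* (2002), §11.3.3 Thm. 11.38, Lemma 11.41; *Hodge Theory II* (2003), Prop. 9.20,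
9.21; W. Fulton, *Intersection Theory* (1998), §19.2 Cor. 19.2 (b).
-/

set_option linter.dupNamespace false

noncomputable section

open Finset
open CategoryTheory CategoryTheory.Limits MonoidalCategory CartesianMonoidalCategory
open Literature.AlgebraicGeometry.Motives Literature.AlgebraicGeometry.HodgeTheory
open Literature.AlgebraicGeometry.HodgeTheory.BettiUniverse
open Summit.HodgeConjecture.HodgeConjecture.Theorems.SignSymmetricPowersMatchingClassesAlgebraic
  (sum_smul_bettiCup_pull_eq_pull_lift sum_toMatrix_mul_smul_eq)
open Summit.HodgeConjecture.HodgeConjecture.Theorems.CyclicUnitaryPowersCupChainFreeSlots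
  (ofRatClass_sum_smul_cupChain_free_mem_algebraicClasses)
open Summit.HodgeConjecture.HodgeConjecture.Theorems.Q8SymplecticPowersSummandHodgeNormalForm
  (subsingleton_bettiCohomology_of_odd_of_b₁)

namespace Summit.HodgeConjecture.HodgeConjecture.Theorems.Q8SymplecticPowersMatchingClassesAlgebraic

variable {X Y : SchemeOver ℂ}

/-- **K2Q brick A-Q, Fulton's fact as a hypothesis: Künneth insertions of graph matching tensors are algebraic.**
For a smooth projective surface `X` with `b₁(X) = 0`, a limit fan `(Y, π)` of `k + 1` copies of `X`, a class
`wdec ∈ H^{2q'}(Y; ℚ)` with algebraic complexification, a Künneth insertion `E : T^{r,0}H²(X) → H^{2q}(Y)` given on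
basis tensors by the left-nested cup chain `wdec ∪ π_{u 0}^* b_{w 0} ∪ ⋯`, a matching `ε : Fin r ≃ (Fin 2 × Fin j) ⊕ Fin l`
whose pairs are tagged by morphisms `g c : X ⟶ X` and whose free slots carry classes `z a` with algebraic
complexification, the image under `E` of the matching tensor
`Σ_w (∏_c ([(g c)^*]_b · G⁻¹)[w(ε⁻¹(0,c)), w(ε⁻¹(1,c))]) (∏ₐ coord(zₐ)[w(ε⁻¹ a)]) · ⊗ᵢ b_{w i}` has algebraic
complexification on `Y`. [cite: VoisinHodgeI2002, §11.3.3 Thm. 11.38 and Lemma 11.41]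
[cite: VoisinHodgeII2003, proof of Prop. 9.20 and Prop. 9.21 (i)] [cite: Fulton1998, §19.2 Cor. 19.2 (b)] -/
theorem graphMatchingClassesAlgebraic_of_fulton (hP : fulton1998_map_mem_algebraicClasses)
    (hX : IsSmoothProjective 2 X) (hb1 : Module.finrank ℚ (bettiCohomology X 1) = 0)
    [Module.Finite ℚ (bettiCohomology X 2)]
    {k : ℕ} (π : Fin (k + 1) → (Y ⟶ X)) (hlim : IsLimit (Fan.mk Y π)) (q q' r : ℕ) (u : Fin r → Fin (k + 1))
    (wdec : bettiCohomology Y (2 * q')) (hwdec : ofRatClass (ComplexPoints Y) (2 * q') wdec ∈ algebraicClasses Y q')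
    (E : hodgeTensorSpace (bettiCohomology X 2) r 0 →ₗ[ℚ] bettiCohomology Y (2 * q))
    (hE : ∀ w : Fin r → Fin (Module.finrank ℚ (bettiCohomology X 2)),
      (⟨2 * q, E ((PiTensorProduct.tprod ℚ fun i => (Module.finBasis ℚ (bettiCohomology X 2)) (w i)) ⊗ₜ[ℚ]
        (PiTensorProduct.tprod ℚ fun i : Fin 0 => (Fin.elim0 i : Module.Dual ℚ (bettiCohomology X 2))))⟩ :
        Σ n, bettiCohomology Y n) =
      List.foldl (fun (acc : Σ n, bettiCohomology Y n) (i : Fin r) =>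
        ⟨acc.1 + 2, cup Y acc.1 2 acc.2 (pull (π (u i)) 2 ((Module.finBasis ℚ (bettiCohomology X 2)) (w i)))⟩)
        ⟨2 * q', wdec⟩ (List.finRange r))
    (j l : ℕ) (ε : Fin r ≃ (Fin 2 × Fin j) ⊕ Fin l) (g : Fin j → (X ⟶ X)) (z : Fin l → bettiCohomology X 2)
    (hz : ∀ a, ofRatClass (ComplexPoints X) (2 * 1) (z a) ∈ algebraicClasses X 1) :
    ofRatClass (ComplexPoints Y) (2 * q) (E (∑ w : Fin r → Fin (Module.finrank ℚ (bettiCohomology X 2)),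
      ((∏ c : Fin j, (LinearMap.toMatrix (Module.finBasis ℚ (bettiCohomology X 2))
          (Module.finBasis ℚ (bettiCohomology X 2)) (pull (g c) 2) *
          (Matrix.of fun a a' => ((cup X 2 2).compr₂ (tr hX (2 + 2)))
            ((Module.finBasis ℚ (bettiCohomology X 2)) a) ((Module.finBasis ℚ (bettiCohomology X 2)) a'))⁻¹)
          (w (ε.symm (Sum.inl (0, c)))) (w (ε.symm (Sum.inl (1, c))))) *
        ∏ a : Fin l, ((Module.finBasis ℚ (bettiCohomology X 2)).repr (z a)) (w (ε.symm (Sum.inr a)))) •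
      ((PiTensorProduct.tprod ℚ fun i => (Module.finBasis ℚ (bettiCohomology X 2)) (w i)) ⊗ₜ[ℚ]
        (PiTensorProduct.tprod ℚ fun i : Fin 0 => (Fin.elim0 i : Module.Dual ℚ (bettiCohomology X 2)))))) ∈
      algebraicClasses Y q := by
  classical
  have hY : IsSmoothProjective (2 * (k + 1)) Y := isSmoothProjective_of_isLimit_fan hX π hlim
  have hXX : IsSmoothProjective (2 + 2) (X ⊗ X) := hX.tensor_holds hX
  have h2 : 2 + 2 = 2 * 2 := rfl
  set b := Module.finBasis ℚ (bettiCohomology X 2) with hb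
  set G : Matrix (Fin (Module.finrank ℚ (bettiCohomology X 2))) (Fin (Module.finrank ℚ (bettiCohomology X 2))) ℚ :=
    Matrix.of fun i i' ↦ ((cup X 2 2).compr₂ (tr hX (2 + 2))) (b i) (b i') with hG
  -- the Poincaré Casimir of `H²(X; ℚ)` on `X × X` is algebraic (`H¹ = H³ = 0`, algebraic `H⁰, H⁴`)
  have hκ : ofRatClass (ComplexPoints (X ⊗ X)) (2 * 2)
      (∑ i, ∑ i', G⁻¹ i i' • bettiCup h2 (pull (fst X X) 2 (b i)) (pull (snd X X) 2 (b i'))) ∈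
      algebraicClasses (X ⊗ X) 2 :=
    ofRatClass_casimir_mem_algebraicClasses hX
      (fun j hj hjn ↦ subsingleton_bettiCohomology_of_odd_of_b₁ hX hb1 hj hjn)
      (fun a z' ha ↦ by
        rw [algebraicClasses_eq_top_of_eq_zero_or_le hX (by omega)]
        exact Submodule.mem_top) b h2
  -- its two-slot pull-backs are algebraic
  have hT : ∀ f' g' : Y ⟶ X, ofRatClass (ComplexPoints Y) (2 * 2)
      (∑ i, ∑ i', G⁻¹ i i' • bettiCup h2 (pull f' 2 (b i)) (pull g' 2 (b i'))) ∈ algebraicClasses Y 2 := by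
    intro f' g'
    rw [sum_smul_bettiCup_pull_eq_pull_lift h2]
    exact ofRatClass_pull_mem_algebraicClasses hP hXX hY (lift f' g') hκ
  -- the two-slot insertions of the graph pair matrices `[(g c)^*]_b · G⁻¹` are algebraic
  have hΘ : ∀ (mm : Fin j) (f' g' : Y ⟶ X), ofRatClass (ComplexPoints Y) (2 * 2)
      (∑ i, ∑ i', (LinearMap.toMatrix b b (pull (g mm) 2) * G⁻¹) i i' •
        bettiCup h2 (pull f' 2 (b i)) (pull g' 2 (b i'))) ∈ algebraicClasses Y 2 := by
    intro mm f' g'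
    have habs := sum_toMatrix_mul_smul_eq b (pull (g mm) 2) G⁻¹
      ((bettiCup h2).compl₁₂ (pull f' 2) (pull g' 2))
    simp only [LinearMap.compl₁₂_apply] at habs
    rw [habs]
    have hg : ∀ x : bettiCohomology X 2, pull f' 2 (pull (g mm) 2 x) = pull (f' ≫ g mm) 2 x := fun x ↦ by
      rw [pull_comp f' (g mm) 2, LinearMap.comp_apply]
    simp only [hg]
    exact hT (f' ≫ g mm) g'
  -- the free slots carry algebraic classes
  have hc : ∀ a : Fin l, ofRatClass (ComplexPoints X) (2 * 1) (∑ i, (b.repr (z a)) i • b i) ∈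
      algebraicClasses X 1 := by
    intro a
    rw [b.sum_repr (z a)]
    exact hz a
  -- the free-slot re-summation theorem
  rw [map_sum E]
  simp only [map_smul]
  exact ofRatClass_sum_smul_cupChain_free_mem_algebraicClasses hP hX hY 1 rfl b π u q' wdec hwdec q
    (fun w ↦ E ((PiTensorProduct.tprod ℚ fun i => b (w i)) ⊗ₜ[ℚ]
      (PiTensorProduct.tprod ℚ fun i : Fin 0 => (Fin.elim0 i : Module.Dual ℚ (bettiCohomology X 2)))))
    hE ε (fun mm i i' ↦ (LinearMap.toMatrix b b (pull (g mm) 2) * G⁻¹) i i') hΘ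
    (fun a i ↦ (b.repr (z a)) i) hc

/-- **K2Q brick A-Q, unconditional**: `graphMatchingClassesAlgebraic_of_fulton` with Fulton's pull-back fact DISCHARGED
(`fulton1998_map_mem_algebraicClasses_holds`). [cite: VoisinHodgeI2002, §11.3.3 Thm. 11.38 and Lemma 11.41]
[cite: Fulton1998, §19.2 Cor. 19.2 (b)] -/
theorem graphMatchingClassesAlgebraic
    (hX : IsSmoothProjective 2 X) (hb1 : Module.finrank ℚ (bettiCohomology X 1) = 0)
    [Module.Finite ℚ (bettiCohomology X 2)]
    {k : ℕ} (π : Fin (k + 1) → (Y ⟶ X)) (hlim : IsLimit (Fan.mk Y π)) (q q' r : ℕ) (u : Fin r → Fin (k + 1))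
    (wdec : bettiCohomology Y (2 * q')) (hwdec : ofRatClass (ComplexPoints Y) (2 * q') wdec ∈ algebraicClasses Y q')
    (E : hodgeTensorSpace (bettiCohomology X 2) r 0 →ₗ[ℚ] bettiCohomology Y (2 * q))
    (hE : ∀ w : Fin r → Fin (Module.finrank ℚ (bettiCohomology X 2)),
      (⟨2 * q, E ((PiTensorProduct.tprod ℚ fun i => (Module.finBasis ℚ (bettiCohomology X 2)) (w i)) ⊗ₜ[ℚ]
        (PiTensorProduct.tprod ℚ fun i : Fin 0 => (Fin.elim0 i : Module.Dual ℚ (bettiCohomology X 2))))⟩ :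
        Σ n, bettiCohomology Y n) =
      List.foldl (fun (acc : Σ n, bettiCohomology Y n) (i : Fin r) =>
        ⟨acc.1 + 2, cup Y acc.1 2 acc.2 (pull (π (u i)) 2 ((Module.finBasis ℚ (bettiCohomology X 2)) (w i)))⟩)
        ⟨2 * q', wdec⟩ (List.finRange r))
    (j l : ℕ) (ε : Fin r ≃ (Fin 2 × Fin j) ⊕ Fin l) (g : Fin j → (X ⟶ X)) (z : Fin l → bettiCohomology X 2)
    (hz : ∀ a, ofRatClass (ComplexPoints X) (2 * 1) (z a) ∈ algebraicClasses X 1) :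
    ofRatClass (ComplexPoints Y) (2 * q) (E (∑ w : Fin r → Fin (Module.finrank ℚ (bettiCohomology X 2)),
      ((∏ c : Fin j, (LinearMap.toMatrix (Module.finBasis ℚ (bettiCohomology X 2))
          (Module.finBasis ℚ (bettiCohomology X 2)) (pull (g c) 2) *
          (Matrix.of fun a a' => ((cup X 2 2).compr₂ (tr hX (2 + 2)))
            ((Module.finBasis ℚ (bettiCohomology X 2)) a) ((Module.finBasis ℚ (bettiCohomology X 2)) a'))⁻¹)
          (w (ε.symm (Sum.inl (0, c)))) (w (ε.symm (Sum.inl (1, c))))) *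
        ∏ a : Fin l, ((Module.finBasis ℚ (bettiCohomology X 2)).repr (z a)) (w (ε.symm (Sum.inr a)))) •
      ((PiTensorProduct.tprod ℚ fun i => (Module.finBasis ℚ (bettiCohomology X 2)) (w i)) ⊗ₜ[ℚ]
        (PiTensorProduct.tprod ℚ fun i : Fin 0 => (Fin.elim0 i : Module.Dual ℚ (bettiCohomology X 2)))))) ∈
      algebraicClasses Y q :=
  graphMatchingClassesAlgebraic_of_fulton fulton1998_map_mem_algebraicClasses_holds hX hb1 π hlim q q' r u wdec
    hwdec E hE j l ε g z hz

end Summit.HodgeConjecture.HodgeConjecture.Theorems.Q8SymplecticPowersMatchingClassesAlgebraic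

end
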